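import Mathlib
import Literature.Analysis.FluidPDE.Tao2016AveragedNS.ShiftSetCascadeFlows
import Summits.NavierStokesRegularity.NavierStokesRegularity.Theorems.TaoLadderRungTwoFlatCertificateGlueCheckerAssembleBoxOn
import HarnessLib

/-!
# Certificate glue on a shift set `𝕊`, XXV-k: THE PRODUCT TABLE AND THE PRODUCT-FORM COVER TEST of the vector-layout checker (glue XIX-h
  `stepCert_of_plohner_mv`, hypotheses `hV`, `hV0`, `hG`, `hGbox`) (helper for items stmt-NavierStokesRegularity-22987 `FlatGapCertificatesV2`
  (crux K_A♭ of route TaoLadderRungTwoFlat) and stmt-24295 K_A₂(64); cell harvest/h2-tao-ladder, p1 g16; theory-1 A-75 (ii), NUM-T41o A75-NOTE: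
  «TEST lo_c ≤ x_c − (ρ_c + E_c + h·V_c(g) + A′) ∧ x_c + (…) ≤ hi_c, V_c(g) = Σ_μ |coefB_{c,μ}| g_a g_b»)

* `prodMag`, `vRowSum` (+ `toReal_vRowSum`, `vRowSum_nonneg`), `vOf`, `pqcN_prod_bound` — the PRODUCT table `V_{(i,k)} = Σ mag(coefB)·g_a·g_b` on the
  weighted box `g = gOf lo hi` and `|PQcN y y|_{(i,k)} ≤ V_{(i,k)}` whenever `|y_d| ≤ g_d` (per-factor coordinate ranges instead of one radius);
* `checkCoverV` / `coverV_at` / `hG_of_checkCoverV` / `inBox_of_checkCoverV` — the cover test C13v and its two consequences: the box magnitudes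
  dominate `|x_c| + ρ_c + E_c + h·V_c` strictly (slack `A' > 0`), and every state within `A'·ω` of the product tube lies in the weighted box.

HONEST FRAMING: Tao-type MODEL lattices (Tao 2016 §4/§6 vocabulary, shift-set parametrised); arithmetic soundness lemmas — no certificate data,
nothing certified, no stub closed, nothing about the Navier–Stokes equations.
-/

-- the sub-problem namespace repeats the summit name by design (D-0017)
set_option linter.dupNamespace false

namespace Summit.NavierStokesRegularity.NavierStokesRegularity.Theorems

open Set Finset Literature.Analysis.FluidPDE Literature.Analysis.FluidPDE.TaoCascade
open Summit.NavierStokesRegularity.NavierStokesRegularity.Theorems.TaylorModelCert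
open Summit.NavierStokesRegularity.NavierStokesRegularity.Theorems.TaylorModelReadout

namespace CertificateGlueOn

variable {m : ℕ} {Kb Ka : ℤ} {ω : Fin m → ℤ → ℝ} {ε₀ : ℝ} {α : Fin m → Fin m → Fin m → ℤ × ℤ × ℤ → ℝ}
  {shifts : List (ℤ × ℤ × ℤ)} {coefB : Fin m → ℤ → Fin m → Fin m → ℤ × ℤ × ℤ → IntervalD}

/-! ### The product table on the weighted box -/

/-- One term of the product table: `mag(coefB)·g_{i₁}(a)·g_{i₂}(b)` if both factors are on the window, else `0`. [folklore] -/
def prodMag (Kb Ka : ℤ) (coefB : Fin m → ℤ → Fin m → Fin m → ℤ × ℤ × ℤ → IntervalD) (loD hiD : Array Dyad) (i : Fin m) (k : ℤ)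
    (i₁ i₂ : Fin m) (μ : ℤ × ℤ × ℤ) : Dyad :=
  if h : (-Kb ≤ k - μ.2.2 + μ.1 ∧ k - μ.2.2 + μ.1 ≤ Ka) ∧ (-Kb ≤ k - μ.2.2 + μ.2.1 ∧ k - μ.2.2 + μ.2.1 ≤ Ka) then
    Dyad.mul (IntervalD.mag (coefB i k i₁ i₂ μ))
      (Dyad.mul (gOf loD hiD (idxOf Kb Ka i₁ (k - μ.2.2 + μ.1) h.1)) (gOf loD hiD (idxOf Kb Ka i₂ (k - μ.2.2 + μ.2.1) h.2)))
  else Dyad.ofInt 0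

/-- `prodMag` is nonnegative. [folklore] -/
theorem prodMag_nonneg (coefB : Fin m → ℤ → Fin m → Fin m → ℤ × ℤ × ℤ → IntervalD) (loD hiD : Array Dyad) (i : Fin m) (k : ℤ)
    (i₁ i₂ : Fin m) (μ : ℤ × ℤ × ℤ) : 0 ≤ (prodMag Kb Ka coefB loD hiD i k i₁ i₂ μ).toReal := by
  unfold prodMag
  split_ifs
  · simp only [Dyad.toReal_mul]
    refine mul_nonneg ?_ (mul_nonneg (gOf_nonneg _ _ _) (gOf_nonneg _ _ _))
    simp only [IntervalD.mag, Dyad.toReal_max, Dyad.toReal_abs]; exact le_max_of_le_left (abs_nonneg _)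
  · simp

/-- Exact dyadic sum of `prodMag` over `(i₁, i₂, μ) ∈ Fin m × Fin m × shifts` at target `(i, k)` — the product table `V_{(i,k)}`. [folklore] -/
def vRowSum (Kb Ka : ℤ) (shifts : List (ℤ × ℤ × ℤ)) (coefB : Fin m → ℤ → Fin m → Fin m → ℤ × ℤ × ℤ → IntervalD) (loD hiD : Array Dyad)
    (i : Fin m) (k : ℤ) : Dyad :=
  (List.finRange m).foldr (fun i₁ acc₁ => Dyad.add ((List.finRange m).foldr (fun i₂ acc₂ => Dyad.add
    (shifts.foldr (fun μ acc₃ => Dyad.add (prodMag Kb Ka coefB loD hiD i k i₁ i₂ μ) acc₃) (Dyad.ofInt 0)) acc₂) (Dyad.ofInt 0)) acc₁)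
    (Dyad.ofInt 0)

/-- The value of `vRowSum` as a triple sum. [folklore] -/
theorem toReal_vRowSum (hnd : shifts.Nodup) (loD hiD : Array Dyad) (i : Fin m) (k : ℤ) :
    (vRowSum Kb Ka shifts coefB loD hiD i k).toReal =
      ∑ i₁ : Fin m, ∑ i₂ : Fin m, ∑ μ ∈ shifts.toFinset, (prodMag Kb Ka coefB loD hiD i k i₁ i₂ μ).toReal := by
  unfold vRowSum
  rw [toReal_foldr_add, Fin.sum_univ_def]
  refine congrArg List.sum (List.map_congr_left fun i₁ _ => ?_)
  rw [toReal_foldr_add, Fin.sum_univ_def]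
  refine congrArg List.sum (List.map_congr_left fun i₂ _ => ?_)
  rw [toReal_foldr_add, List.sum_toFinset _ hnd]

/-- `vRowSum` is nonnegative. [folklore] -/
theorem vRowSum_nonneg (hnd : shifts.Nodup) (loD hiD : Array Dyad) (i : Fin m) (k : ℤ) :
    0 ≤ (vRowSum Kb Ka shifts coefB loD hiD i k).toReal := by
  rw [toReal_vRowSum hnd]
  exact Finset.sum_nonneg fun i₁ _ => Finset.sum_nonneg fun i₂ _ => Finset.sum_nonneg fun μ _ => prodMag_nonneg _ _ _ _ _ _ _ _

/-- The real product table read at a coordinate `d ↔ (i,k)`. [folklore] -/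
noncomputable def vOf (Kb Ka : ℤ) (shifts : List (ℤ × ℤ × ℤ)) (coefB : Fin m → ℤ → Fin m → Fin m → ℤ × ℤ × ℤ → IntervalD)
    (loD hiD : Array Dyad) (d : Fin (m * winLen Kb Ka)) : ℝ :=
  (vRowSum Kb Ka shifts coefB loD hiD (finProdFinEquiv.symm d).1 (shellAt Kb (finProdFinEquiv.symm d).2)).toReal

/-- A truncated weighted state with coordinates in the weighted box is bounded by `ω · g` per window index. [folklore] -/
theorem abs_truncAt_pwstate_le_gOf (hω : ∀ i k, 0 < ω i k) (hKK : 0 ≤ Ka + Kb + 1) (loD hiD : Array Dyad)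
    {y : Fin (m * winLen Kb Ka) → ℝ} (hy : ∀ d, |y d| ≤ (gOf loD hiD d).toReal) (i : Fin m) {n : ℤ} (hn : -Kb ≤ n ∧ n ≤ Ka) :
    |truncAt Kb Ka (pwstate Kb Ka ω (y ∘ finProdFinEquiv)) i n| ≤ ω i n * (gOf loD hiD (idxOf Kb Ka i n hn)).toReal := by
  unfold truncAt
  rw [if_pos hn]
  have hlt : (n + Kb).toNat < winLen Kb Ka := by
    unfold winLen; rw [Int.toNat_lt_toNat (by omega)]; omega
  set c : Fin (winLen Kb Ka) := ⟨(n + Kb).toNat, hlt⟩ with hc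
  have hsh : shellAt Kb c = n := by
    simp only [shellAt, hc]; rw [Int.toNat_of_nonneg (by omega)]; ring
  have h1 := pwstate_on (ω := ω) (y ∘ finProdFinEquiv) hKK i c
  rw [hsh] at h1
  rw [h1, abs_mul, abs_of_pos (hω i n)]
  refine mul_le_mul_of_nonneg_left ?_ (hω i n).le
  have := hy (finProdFinEquiv (i, c))
  simpa [idxOf, hc] using this

/-- A truncated state vanishes off the window. [folklore] -/
theorem truncAt_off' {U : Fin m → ℤ → ℝ} (i : Fin m) {n : ℤ} (hn : ¬(-Kb ≤ n ∧ n ≤ Ka)) : truncAt Kb Ka U i n = 0 := by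
  unfold truncAt; rw [if_neg hn]

/-- **The product-form bilinear bound**: for `|y_d| ≤ g_d` on the weighted box, `|PQcN y y|_d ≤ V_d`, `V = vOf` (the hypothesis `hV` of glue XIX-h).
[folklore] -/
theorem pqcN_prod_bound (hKb : 0 ≤ Kb) (hKa : 1 ≤ Ka) (hω : ∀ i k, 0 < ω i k) (hε : 0 < 1 + ε₀) (hnd : shifts.Nodup)
    (hcoef : CoefBoxOK shifts ε₀ α Kb Ka ω coefB) (loD hiD : Array Dyad) :
    ∀ y : Fin (m * winLen Kb Ka) → ℝ, (∀ d, |y d| ≤ (gOf loD hiD d).toReal) →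
      ∀ d, |PQcN shifts.toFinset ε₀ α Kb Ka ω y y d| ≤ vOf Kb Ka shifts coefB loD hiD d := by
  intro y hy d
  have hKK : 0 ≤ Ka + Kb + 1 := by omega
  set c := finProdFinEquiv.symm d with hc
  set k := shellAt Kb c.2 with hk
  obtain ⟨hk1, hk2⟩ := shellAt_mem hKK c.2
  rw [← hk] at hk1 hk2
  have hval : PQcN shifts.toFinset ε₀ α Kb Ka ω y y d =
      biFieldOn shifts.toFinset ε₀ α Kb Ka (pwstate Kb Ka ω (y ∘ finProdFinEquiv)) (pwstate Kb Ka ω (y ∘ finProdFinEquiv)) c.1 k /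
        ω c.1 k := by
    simp only [PQcN, PQc, pwcoord, ← hc, ← hk]
  unfold vOf
  rw [← hc, ← hk, hval, abs_div, abs_of_pos (hω c.1 k), div_le_iff₀ (hω c.1 k), toReal_vRowSum hnd]
  unfold biFieldOn
  refine (Finset.abs_sum_le_sum_abs _ _).trans ?_
  rw [Finset.sum_mul]
  refine Finset.sum_le_sum fun i₁ _ => ?_
  refine (Finset.abs_sum_le_sum_abs _ _).trans ?_
  rw [Finset.sum_mul]
  refine Finset.sum_le_sum fun i₂ _ => ?_
  refine (Finset.abs_sum_le_sum_abs _ _).trans ?_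
  rw [Finset.sum_mul]
  refine Finset.sum_le_sum fun μ hμ => ?_
  have hμ' : μ ∈ shifts := List.mem_toFinset.mp hμ
  have hc0 : 0 < (1 + ε₀) ^ ((5 : ℝ) * (k - μ.2.2) / 2) := Real.rpow_pos_of_pos hε _
  by_cases ha : -Kb ≤ k - μ.2.2 + μ.1 ∧ k - μ.2.2 + μ.1 ≤ Ka
  · by_cases hb : -Kb ≤ k - μ.2.2 + μ.2.1 ∧ k - μ.2.2 + μ.2.1 ≤ Ka
    · have h1 := abs_truncAt_pwstate_le_gOf hω hKK loD hiD hy i₁ ha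
      have h2 := abs_truncAt_pwstate_le_gOf hω hKK loD hiD hy i₂ hb
      have hmag := IntervalD.abs_le_mag (hcoef c.1 k i₁ i₂ μ hμ' hk1 hk2)
      set g1 := (gOf loD hiD (idxOf Kb Ka i₁ (k - μ.2.2 + μ.1) ha)).toReal with hg1
      set g2 := (gOf loD hiD (idxOf Kb Ka i₂ (k - μ.2.2 + μ.2.1) hb)).toReal with hg2
      have hg1n : 0 ≤ g1 := gOf_nonneg _ _ _
      have hg2n : 0 ≤ g2 := gOf_nonneg _ _ _
      have hpm : (prodMag Kb Ka coefB loD hiD c.1 k i₁ i₂ μ).toReal = (IntervalD.mag (coefB c.1 k i₁ i₂ μ)).toReal * (g1 * g2) := by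
        simp only [prodMag, dif_pos (And.intro ha hb), Dyad.toReal_mul]
        rfl
      rw [hpm, abs_mul, abs_mul, abs_mul, abs_of_pos hc0]
      have hne : ω c.1 k ≠ 0 := (hω c.1 k).ne'
      have hwa : 0 ≤ ω i₁ (k - μ.2.2 + μ.1) * g1 := mul_nonneg (hω _ _).le hg1n
      calc |α i₁ i₂ c.1 μ| * (1 + ε₀) ^ ((5 : ℝ) * (k - μ.2.2) / 2) *
            (|truncAt Kb Ka (pwstate Kb Ka ω (y ∘ finProdFinEquiv)) i₁ (k - μ.2.2 + μ.1)| *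
              |truncAt Kb Ka (pwstate Kb Ka ω (y ∘ finProdFinEquiv)) i₂ (k - μ.2.2 + μ.2.1)|)
          ≤ |α i₁ i₂ c.1 μ| * (1 + ε₀) ^ ((5 : ℝ) * (k - μ.2.2) / 2) *
            ((ω i₁ (k - μ.2.2 + μ.1) * g1) * (ω i₂ (k - μ.2.2 + μ.2.1) * g2)) :=
            mul_le_mul_of_nonneg_left (mul_le_mul h1 h2 (abs_nonneg _) hwa) (mul_nonneg (abs_nonneg _) hc0.le)
        _ = |pcoef ε₀ α ω c.1 k i₁ i₂ μ| * (g1 * g2) * ω c.1 k := by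
            unfold pcoef
            rw [abs_mul, abs_mul, abs_of_pos hc0, abs_div, abs_of_pos (hω c.1 k), abs_mul, abs_of_pos (hω i₁ _), abs_of_pos (hω i₂ _)]
            field_simp
        _ ≤ (IntervalD.mag (coefB c.1 k i₁ i₂ μ)).toReal * (g1 * g2) * ω c.1 k :=
            mul_le_mul_of_nonneg_right (mul_le_mul_of_nonneg_right hmag (mul_nonneg hg1n hg2n)) (hω c.1 k).le
    · rw [truncAt_off' i₂ hb]
      simp only [abs_zero, mul_zero]
      exact mul_nonneg (prodMag_nonneg _ _ _ _ _ _ _ _) (hω c.1 k).le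
  · rw [truncAt_off' i₁ ha]
    simp only [abs_zero, zero_mul, mul_zero]
    exact mul_nonneg (prodMag_nonneg _ _ _ _ _ _ _ _) (hω c.1 k).le

/-! ### C13v: the product-form cover test -/

/-- **The product-form cover test** (C13v): per window coordinate `c = idx(i,k)`, `lo_c ≤ x_c − w_c` and `x_c + w_c ≤ hi_c` with
`w_c = ρ_c + E_c + h·V_{(i,k)} + A'`, `V` the product table on the box `[lo, hi]` itself. [folklore] -/
def checkCoverV (m : ℕ) (Kb Ka : ℤ) (shifts : List (ℤ × ℤ × ℤ)) (coefB : Fin m → ℤ → Fin m → Fin m → ℤ × ℤ × ℤ → IntervalD)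
    (xD ρD ED loD hiD : Array Dyad) (h A' : ℚ) : Bool :=
  (List.finRange m).all fun i => (List.range (winLen Kb Ka)).all fun cc =>
    let c := cc + winLen Kb Ka * i.val
    let w : ℚ := dyadToRat (dgetD ρD c) + dyadToRat (dgetD ED c) + h * dyadToRat (vRowSum Kb Ka shifts coefB loD hiD i ((cc : ℤ) - Kb)) + A'
    decide (dyadToRat (dgetD loD c) ≤ dyadToRat (dgetD xD c) - w) && decide (dyadToRat (dgetD xD c) + w ≤ dyadToRat (dgetD hiD c))

/-- The two inequalities of the cover test at a window coordinate, in `ℝ`. [folklore] -/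
theorem coverV_at {shifts : List (ℤ × ℤ × ℤ)} {coefB : Fin m → ℤ → Fin m → Fin m → ℤ × ℤ × ℤ → IntervalD}
    {xD ρD ED loD hiD : Array Dyad} {h A' : ℚ} (hc : checkCoverV m Kb Ka shifts coefB xD ρD ED loD hiD h A' = true)
    (i : Fin m) {k : ℤ} (hw : -Kb ≤ k ∧ k ≤ Ka) :
    (dgetD loD (idxOf Kb Ka i k hw)).toReal ≤ (dgetD xD (idxOf Kb Ka i k hw)).toReal -
        ((dgetD ρD (idxOf Kb Ka i k hw)).toReal + (dgetD ED (idxOf Kb Ka i k hw)).toReal +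
          (h : ℝ) * (vRowSum Kb Ka shifts coefB loD hiD i k).toReal + (A' : ℝ)) ∧
      (dgetD xD (idxOf Kb Ka i k hw)).toReal +
        ((dgetD ρD (idxOf Kb Ka i k hw)).toReal + (dgetD ED (idxOf Kb Ka i k hw)).toReal +
          (h : ℝ) * (vRowSum Kb Ka shifts coefB loD hiD i k).toReal + (A' : ℝ)) ≤ (dgetD hiD (idxOf Kb Ka i k hw)).toReal := by
  simp only [checkCoverV, List.all_eq_true, List.mem_finRange, List.mem_range, Bool.and_eq_true, decide_eq_true_eq,
    true_implies] at hc
  have hcc : (k + Kb).toNat < winLen Kb Ka := by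
    unfold winLen; rw [Int.toNat_lt_toNat (by omega)]; omega
  obtain ⟨h1, h2⟩ := hc i (k + Kb).toNat hcc
  rw [Int.toNat_of_nonneg (by omega), show k + Kb - Kb = k by ring] at h1 h2
  rw [idxOf_val i hw]
  constructor
  · have := (Rat.cast_le (K := ℝ)).mpr h1
    simp only [Rat.cast_sub, Rat.cast_add, Rat.cast_mul, cast_dyadToRat] at this
    exact this
  · have := (Rat.cast_le (K := ℝ)).mpr h2
    simp only [Rat.cast_add, Rat.cast_mul, cast_dyadToRat] at this
    exact this

/-- **C13v ⇒ `hG`**: the box magnitudes dominate `|x_c| + ρ_c + E_c + h V_c` STRICTLY (the slack is `A' > 0`). [folklore] -/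
theorem hG_of_checkCoverV {shifts : List (ℤ × ℤ × ℤ)} (hnd : shifts.Nodup) {coefB : Fin m → ℤ → Fin m → Fin m → ℤ × ℤ × ℤ → IntervalD}
    {xD ρD ED loD hiD : Array Dyad} {h A' : ℚ} (hA' : 0 < A') (hc : checkCoverV m Kb Ka shifts coefB xD ρD ED loD hiD h A' = true)
    (hKK : 0 ≤ Ka + Kb + 1) :
    ∀ d : Fin (m * winLen Kb Ka), |dvec (n := m * winLen Kb Ka) xD d| +
        (dvec (n := m * winLen Kb Ka) ρD d + dvec (n := m * winLen Kb Ka) ED d) + (h : ℝ) * vOf Kb Ka shifts coefB loD hiD d <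
      (gOf loD hiD d).toReal := by
  intro d
  obtain ⟨hk1, hk2⟩ := shellAt_mem hKK (finProdFinEquiv.symm d).2
  have hw : -Kb ≤ shellAt Kb (finProdFinEquiv.symm d).2 ∧ shellAt Kb (finProdFinEquiv.symm d).2 ≤ Ka := ⟨hk1, hk2⟩
  -- the array index of `d` is that of its window pair
  have hdv : (shellAt Kb (finProdFinEquiv.symm d).2 + Kb).toNat + winLen Kb Ka * ((finProdFinEquiv.symm d).1 : ℕ) = (d : ℕ) := by
    have e1 : (shellAt Kb (finProdFinEquiv.symm d).2 + Kb).toNat = ((finProdFinEquiv.symm d).2 : ℕ) := by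
      simp only [shellAt, sub_add_cancel, Int.toNat_natCast]
    rw [e1]
    conv_rhs => rw [← finProdFinEquiv.apply_symm_apply d]
    rw [finProdFinEquiv_apply_val]
  obtain ⟨h1, h2⟩ := coverV_at hc (finProdFinEquiv.symm d).1 hw
  rw [idxOf_val _ hw, hdv] at h1 h2
  have hA'r : (0 : ℝ) < (A' : ℝ) := by exact_mod_cast hA'
  unfold vOf
  simp only [dvec, gOf, Dyad.toReal_max, Dyad.toReal_abs]
  have hnn := vRowSum_nonneg (Kb := Kb) (Ka := Ka) (coefB := coefB) hnd loD hiD (finProdFinEquiv.symm d).1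
    (shellAt Kb (finProdFinEquiv.symm d).2)
  rcases le_or_gt 0 (dgetD xD d).toReal with hx | hx
  · rw [abs_of_nonneg hx]
    have : (dgetD hiD d).toReal ≤ |(dgetD hiD d).toReal| := le_abs_self _
    have := le_max_right |(dgetD loD d).toReal| |(dgetD hiD d).toReal|
    linarith
  · rw [abs_of_neg hx]
    have : -(dgetD loD d).toReal ≤ |(dgetD loD d).toReal| := neg_le_abs _
    have := le_max_left |(dgetD loD d).toReal| |(dgetD hiD d).toReal|
    linarith

/-- **C13v ⇒ `hGbox`**: every state within `A'·ω` of a state in the product tube (at any `u ≤ h`) lies in the weighted box `[wbox lo, wbox hi]`. [folklore] -/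
theorem inBox_of_checkCoverV {shifts : List (ℤ × ℤ × ℤ)} (hnd : shifts.Nodup) {coefB : Fin m → ℤ → Fin m → Fin m → ℤ × ℤ × ℤ → IntervalD}
    {ωq : Fin m → ℤ → ℚ} (hω : ∀ i k, 0 < ωq i k) {xD ρD ED loD hiD : Array Dyad} {h A' : ℚ}
    (hc : checkCoverV m Kb Ka shifts coefB xD ρD ED loD hiD h A' = true) {u : ℝ} (hu : u ∈ Icc (0 : ℝ) (h : ℝ)) {q y : Fin m → ℤ → ℝ}
    (hq : ∀ c, |pxcoord Kb Ka (fun i k => (ωq i k : ℝ)) q c - dvec (n := m * winLen Kb Ka) xD c| ≤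
      dvec (n := m * winLen Kb Ka) ρD c + dvec (n := m * winLen Kb Ka) ED c + u * vOf Kb Ka shifts coefB loD hiD c)
    (hnear : ∀ i k, -Kb ≤ k → k ≤ Ka → |y i k - q i k| ≤ (A' : ℝ) * (ωq i k : ℝ)) :
    InBoxOn Kb Ka (wbox Kb Ka (fun i k => (ωq i k : ℝ)) loD) (wbox Kb Ka (fun i k => (ωq i k : ℝ)) hiD) y := by
  intro i k hk1 hk2
  have hw : -Kb ≤ k ∧ k ≤ Ka := ⟨hk1, hk2⟩
  have hcc : (k + Kb).toNat < winLen Kb Ka := by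
    unfold winLen; rw [Int.toNat_lt_toNat (by omega)]; omega
  obtain ⟨h1, h2⟩ := coverV_at hc i hw
  have hidx := idxOf_val (Kb := Kb) (Ka := Ka) i hw
  -- the tube bound at the coordinate `c = idx(i,k)`
  have hpc := hq (idxOf Kb Ka i k hw)
  rw [pxcoord_idxOf q i hw] at hpc
  have hsymm : finProdFinEquiv.symm (idxOf Kb Ka i k hw) = (i, ⟨(k + Kb).toNat, hcc⟩) := by
    unfold idxOf; rw [Equiv.symm_apply_apply]
  have hsh : shellAt Kb (⟨(k + Kb).toNat, hcc⟩ : Fin (winLen Kb Ka)) = k := by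
    simp only [shellAt]; rw [Int.toNat_of_nonneg (by omega)]; ring
  unfold vOf at hpc
  simp only [hsymm, hsh, dvec] at hpc
  rw [hidx] at h1 h2 hpc
  -- names
  have hωk : (0 : ℝ) < (ωq i k : ℝ) := by exact_mod_cast hω i k
  set W : ℝ := (ωq i k : ℝ) with hW
  set V : ℝ := (vRowSum Kb Ka shifts coefB loD hiD i k).toReal with hV
  set X : ℝ := (dgetD xD ((k + Kb).toNat + winLen Kb Ka * i.val)).toReal with hX
  set P : ℝ := (dgetD ρD ((k + Kb).toNat + winLen Kb Ka * i.val)).toReal with hP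
  set EE : ℝ := (dgetD ED ((k + Kb).toNat + winLen Kb Ka * i.val)).toReal with hEE
  set L : ℝ := (dgetD loD ((k + Kb).toNat + winLen Kb Ka * i.val)).toReal with hL
  set U : ℝ := (dgetD hiD ((k + Kb).toNat + winLen Kb Ka * i.val)).toReal with hU
  have hV0 : 0 ≤ V := vRowSum_nonneg hnd loD hiD i k
  have hPt : |q i k / W - X| ≤ P + EE + (h : ℝ) * V := hpc.trans (by nlinarith [hu.2, hV0])
  have hqW : q i k = W * (q i k / W) := by field_simp
  have hn := hnear i k hk1 hk2
  rw [abs_le] at hPt hn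
  have hlo : wbox Kb Ka (fun i k => (ωq i k : ℝ)) loD i k = W * L := by
    unfold wbox; rw [dif_pos hw, hidx]
  have hhi : wbox Kb Ka (fun i k => (ωq i k : ℝ)) hiD i k = W * U := by
    unfold wbox; rw [dif_pos hw, hidx]
  rw [hlo, hhi]
  constructor
  · have : W * L ≤ W * (q i k / W) - (A' : ℝ) * W := by
      have := mul_le_mul_of_nonneg_left h1 hωk.le
      nlinarith
    linarith [hqW]
  · have : W * (q i k / W) + (A' : ℝ) * W ≤ W * U := by
      have := mul_le_mul_of_nonneg_left h2 hωk.le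
      nlinarith
    linarith [hqW]

end CertificateGlueOn

end Summit.NavierStokesRegularity.NavierStokesRegularity.Theorems
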